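import Mathlib.NumberTheory.ArithmeticFunction.Liouville
import Mathlib.NumberTheory.ArithmeticFunction.Misc
import Mathlib.Data.ZMod.Basic
import Mathlib.Algebra.Squarefree.Basic
import HarnessLib

/-!
# Stub `stub_sqfreeSign` (line `SketchIdeator2`, crux `MobiusLadder.LiouvilleNotPPoly`)

The elementary mod-3 count behind the root-number formula on the `X₁(3)` family
`E_t : y² + xy + ty = x³`: on the promise that `t(27t−1)` is squarefree,
`−(−1)^{ω(t)} · (−1)^{ω₁(27t−1)} = λ(t) · λ(27t−1)`, where `ω₁(m)` counts the prime factors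
`p ≡ 1 (mod 3)` of `m`.

Proof: for squarefree `n ≠ 0`, `λ n = (−1)^{Ω n} = (−1)^{ω n}`; `m := 27t − 1 ≡ 2 (mod 3)` is
squarefree, so in `ZMod 3` it is the product of its prime factors, each `≡ 1` or `≡ 2 ≡ −1`, whence
the number `ω₂` of prime factors `≢ 1 (mod 3)` is odd; finally `ω m = ω₁ + ω₂`.
-/

set_option linter.dupNamespace false -- D-0017: single-problem summit ⇒ QuantumAdvantage.QuantumAdvantage by design

namespace Summit.QuantumAdvantage.QuantumAdvantage.Theorems.LiouvilleNotPPoly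

open ArithmeticFunction

/-- For squarefree `n ≠ 0`, `λ n = (-1) ^ ω n`. -/
theorem liouville_eq_neg_one_pow_cardDistinctFactors {n : ℕ} (hn : n ≠ 0)
    (hsq : Squarefree n) : liouville n = (-1) ^ cardDistinctFactors n := by
  rw [liouville_apply hn, (cardDistinctFactors_eq_cardFactors_iff_squarefree hn).mpr hsq]

/-- `ω n = #n.primeFactors`. -/
theorem cardDistinctFactors_eq_card_primeFactors (n : ℕ) :
    cardDistinctFactors n = n.primeFactors.card := by
  rw [cardDistinctFactors_apply, ← List.card_toFinset]; rfl

/-- A natural number cast into `ZMod 3` equals the cast of its residue mod `3`. -/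
theorem natCast_zmod_three (a : ℕ) : (a : ZMod 3) = ((a % 3 : ℕ) : ZMod 3) :=
  (ZMod.natCast_mod a 3).symm

/-- If `m ≡ 2 (mod 3)` is squarefree, then the number of prime factors `p` of `m` with
`p % 3 ≠ 1` (equivalently `p ≡ 2 (mod 3)`) is odd. -/
theorem odd_card_primeFactors_filter_not_mod_three_eq_one {m : ℕ} (hm : m % 3 = 2)
    (hsq : Squarefree m) :
    Odd (m.primeFactors.filter fun p => ¬p % 3 = 1).card := by
  -- every prime factor `p` of `m` satisfies `p % 3 = 1` or `p % 3 = 2`, as `3 ∤ m`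
  have hmod : ∀ p ∈ m.primeFactors, ¬p % 3 = 1 → p % 3 = 2 := by
    intro p hp hp1
    have hpd : p ∣ m := Nat.dvd_of_mem_primeFactors hp
    have hp0 : p % 3 ≠ 0 := by
      intro h0
      have h3 : 3 ∣ m := dvd_trans (Nat.dvd_of_mod_eq_zero h0) hpd
      omega
    omega
  -- in `ZMod 3`, `m` is the product of its prime factors
  have hprod : (m : ZMod 3) = ∏ p ∈ m.primeFactors, (p : ZMod 3) := by
    rw [← Nat.cast_prod, Nat.prod_primeFactors_of_squarefree hsq]
  rw [← Finset.prod_filter_mul_prod_filter_not m.primeFactors (fun p => p % 3 = 1)] at hprod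
  have h1 : ∏ p ∈ m.primeFactors.filter (fun p => p % 3 = 1), (p : ZMod 3) = 1 := by
    refine Finset.prod_eq_one fun p hp => ?_
    rw [Finset.mem_filter] at hp
    rw [natCast_zmod_three p, hp.2]
    rfl
  have h2 : ∏ p ∈ m.primeFactors.filter (fun p => ¬p % 3 = 1), (p : ZMod 3) =
      (-1) ^ (m.primeFactors.filter fun p => ¬p % 3 = 1).card := by
    rw [← Finset.prod_const]
    refine Finset.prod_congr rfl fun p hp => ?_
    rw [Finset.mem_filter] at hp
    rw [natCast_zmod_three p, hmod p hp.1 hp.2]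
    rfl
  have hm' : (m : ZMod 3) = -1 := by
    rw [natCast_zmod_three m, hm]
    rfl
  rw [h1, h2, one_mul, hm'] at hprod
  by_contra hodd
  rw [Nat.not_odd_iff_even] at hodd
  rw [hodd.neg_one_pow] at hprod
  exact absurd hprod (by decide)

/-- **Stub B · `stub_sqfreeSign`.** On the squarefree locus `t(27t−1)` squarefree (`t ≥ 1`),
`−(−1)^{ω(t)} · (−1)^{#{p ∣ 27t−1 prime : p ≡ 1 (mod 3)}} = λ(t) · λ(27t−1)`. -/
theorem stub_sqfreeSign :
    ∀ t : ℕ, 1 ≤ t → Squarefree (t * (27 * t - 1)) →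
    -((-1 : ℤ) ^ ArithmeticFunction.cardDistinctFactors t) *
        (-1) ^ ((27 * t - 1).primeFactors.filter fun p => p % 3 = 1).card =
      ArithmeticFunction.liouville t * ArithmeticFunction.liouville (27 * t - 1) := by
  intro t ht hsq
  have ht0 : t ≠ 0 := by omega
  have hm0 : 27 * t - 1 ≠ 0 := by omega
  have hm3 : (27 * t - 1) % 3 = 2 := by omega
  have hsqt : Squarefree t := hsq.of_mul_left
  have hsqm : Squarefree (27 * t - 1) := hsq.of_mul_right
  rw [liouville_eq_neg_one_pow_cardDistinctFactors ht0 hsqt,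
    liouville_eq_neg_one_pow_cardDistinctFactors hm0 hsqm,
    cardDistinctFactors_eq_card_primeFactors (27 * t - 1),
    ← Finset.card_filter_add_card_filter_not (s := (27 * t - 1).primeFactors)
      (fun p => p % 3 = 1),
    pow_add, (odd_card_primeFactors_filter_not_mod_three_eq_one hm3 hsqm).neg_one_pow]
  ring

end Summit.QuantumAdvantage.QuantumAdvantage.Theorems.LiouvilleNotPPoly
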